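import Literature.NumberTheory.GaloisRepresentations.GaloisCohomologyLayerInflationTwo
import Literature.NumberTheory.GaloisRepresentations.ProfiniteIntersectionCocycleExtension
import Literature.NumberTheory.GaloisRepresentations.GaloisCohomologyProofs
import HarnessLib

/-!
# `H²(K, M) = ⋃_E inf H²(Gal(E/K), M)` for a finite discrete `Γ_K`-module `M`
# (Serre, *Galois Cohomology* I §2.2 Prop. 8 and Cor. 1: `H^q(G, A) = lim→ H^q(G/U, A^U)`, degree `q = 2`)

Topic `NumberTheory/GaloisRepresentations`; namespace `Literature.NumberTheory.GaloisRepresentations`.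
Proof file: theorems only (no definition, no named fact, no instance, no notation; D-0026).  Companion of
`GaloisCohomologyLayerInflationTwo` (door-c6 g9: `infTwo ρ E : H²(Γ_K ⧸ Γ_E, M^{Γ_E}) →+ H²(K, M)` out of
Mathlib's finite-group `groupCohomology`, cocycle formula `infTwo_H2π`) and of the tree's degree-one union
`galoisCohomology.exists_inf_eq_one_holds` (`GaloisCohomologyProofs`).

* **`exists_infTwo_eq`** — for a field `K : Type` and a FINITE discrete `Γ_K`-module `M`, every class of
  `H²(K, M)` is `infTwo ρ E y` for some finite Galois `E ⊆ K̄` and some `y ∈ H²(Γ_K ⧸ Γ_E, M^{Γ_E})`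
  (Mathlib `groupCohomology (absGaloisLayerRep K E ρ) 2`).  Proof (Serre's): a continuous inhomogeneous
  2-cocycle `c : Γ_K × Γ_K → M` is uniformly locally constant (`exists_nhds_one_forall_eq'`, compactness of
  `Γ_K × Γ_K`); the kernel of the action on the finite `M` is a neighbourhood of `1`; an open normal
  `Γ_E = Gal(K̄/E)`, `E/K` finite Galois, inside both (`exists_finiteDimensional_isGalois_of_mem_nhds_one`)
  makes `c` constant on `Γ_E`-cosets with `Γ_E`-invariant values, i.e. a 2-cocycle of the finite group
  `Γ_K ⧸ Γ_E` with values in `M = M^{Γ_E}`, whose inflation is `c` on the nose (`infTwo_H2π`).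
* `twoCocycle_const_of_mem` — the constancy statement used.

With `exists_infOneLayer_eq` (degree one, `GaloisCohomologyLayerInflationCup`) this gives Serre I §2.2
Cor. 1 in the two degrees that the Poitou–Tate assembly of the bsd-schneider cell (Route A; Milne I Lemma
1.9, 4.13) consumes.  Not here: infinite discrete `M` (same proof with the stabilisers of the finitely
many values of `c`), and the injectivity side (`inf x = 0 ⟹ x` dies at a deeper finite layer).
-- TODO(general form): arbitrary discrete `M` (Serre I §2.2 Prop. 8 for all `A ∈ C_G`).

## References
* J.-P. Serre, *Galois Cohomology* (1997), Ch. I §2.2 Prop. 8 and Cor. 1. [SerreGaloisCohomology1997]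
* J. Neukirch, A. Schmidt, K. Wingberg, *Cohomology of Number Fields* (2008), (1.2.5), (1.5.1).
  [NeukirchSchmidtWingberg2008]
-/

noncomputable section

open CategoryTheory groupCohomology Field Function
open scoped Topology

namespace Literature.NumberTheory.GaloisRepresentations

open LocalWeilDatum

variable (K : Type) [Field K]
variable {M : Type} [AddCommGroup M] [TopologicalSpace M] [DiscreteTopology M] (ρ : DiscreteGaloisModule K M)

/-- **Uniform local constancy of a continuous 2-cocycle on cosets of a small open subgroup**: if
`Γ_E × Γ_E'`-translates stay inside a neighbourhood `V` of `1` on which `c(z · v) = c(z)`, then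
`c(σ u, τ u') = c(σ, τ)` for `u, u' ∈ Γ_E`. [cite: SerreGaloisCohomology1997, I §2.2 Prop. 8 (proof)] -/
theorem twoCocycle_const_of_mem (c : contTwoCocycles ρ.toTopRep)
    {V : Set (absoluteGaloisGroup K × absoluteGaloisGroup K)}
    (hVc : ∀ z : absoluteGaloisGroup K × absoluteGaloisGroup K, ∀ v ∈ V, c.1 (z * v) = c.1 (z * 1))
    {U : Set (absoluteGaloisGroup K)} (hUV : U ×ˢ U ⊆ V)
    {σ τ u u' : absoluteGaloisGroup K} (hu : u ∈ U) (hu' : u' ∈ U) :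
    c.1 (σ * u, τ * u') = c.1 (σ, τ) := by
  have h := hVc (σ, τ) (u, u') (hUV (Set.mk_mem_prod hu hu'))
  rwa [mul_one, Prod.mk_mul_mk] at h

/-- **`H²(K, M)` is the union of the inflations from its finite Galois layers, for finite `M`**
(Serre I §2.2 Cor. 1 to Prop. 8 in degree `2`): every `x ∈ H²(K, M)` is `infTwo ρ E y` for a finite Galois
`E ⊆ K̄` and a class `y` of Mathlib's `H²(Γ_K ⧸ Γ_E, M^{Γ_E})`.
[cite: SerreGaloisCohomology1997, I §2.2 Prop. 8 and Cor. 1][cite: NeukirchSchmidtWingberg2008, (1.2.5)] -/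
theorem exists_infTwo_eq [Finite M] (x : galoisCohomology ρ 2) :
    ∃ (E : IntermediateField K (AlgebraicClosure K)) (_ : FiniteDimensional K E) (_ : IsGalois K E)
      (y : groupCohomology (absGaloisLayerRep K E ρ) 2), infTwo K E ρ y = x := by
  classical
  haveI : CompactSpace (absoluteGaloisGroup K) := absoluteGaloisGroup_compactSpace K
  -- a continuous inhomogeneous 2-cocycle representing `x`
  obtain ⟨c, rfl⟩ := twoCocycleClass_surjective ρ.toTopRep x
  -- the kernel of the action on the finite module is a neighbourhood of `1`
  have hU₀ : (⋂ a : M, {g : absoluteGaloisGroup K | ρ g a = a}) ∈ 𝓝 (1 : absoluteGaloisGroup K) :=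
    (Filter.iInter_mem).2 fun a => ρ.setOf_apply_eq_mem_nhds_one a
  -- uniform local constancy of `c`
  obtain ⟨V, hV, hVc⟩ := exists_nhds_one_forall_eq'
    (X := absoluteGaloisGroup K × absoluteGaloisGroup K) (P := absoluteGaloisGroup K × absoluteGaloisGroup K)
    (fun z v => c.1 (z * v)) (c.1.continuous.comp continuous_mul)
  obtain ⟨V₁, hV₁, V₂, hV₂, hV₁₂⟩ := mem_nhds_prod_iff.1 hV
  -- a finite Galois `E` with `Γ_E` inside everything
  obtain ⟨E, hEfd, hEgal, hEU⟩ := exists_finiteDimensional_isGalois_of_mem_nhds_one K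
    (Filter.inter_mem hU₀ (Filter.inter_mem hV₁ hV₂))
  haveI := hEfd
  haveI := hEgal
  have hmemU : ∀ u ∈ absGaloisFixingSubgroup E,
      u ∈ (⋂ a : M, {g : absoluteGaloisGroup K | ρ g a = a}) ∩ (V₁ ∩ V₂) := fun u hu =>
    hEU u ((mem_absGaloisFixingSubgroup_iff E u).1 hu)
  have htriv : ∀ u ∈ absGaloisFixingSubgroup E, ∀ a : M, ρ u a = a := fun u hu a =>
    Set.mem_iInter.1 (hmemU u hu).1 a
  have hconst : ∀ σ τ u u' : absoluteGaloisGroup K, u ∈ absGaloisFixingSubgroup E →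
      u' ∈ absGaloisFixingSubgroup E → c.1 (σ * u, τ * u') = c.1 (σ, τ) := fun σ τ u u' hu hu' =>
    twoCocycle_const_of_mem K ρ c hVc (U := V₁ ∩ V₂)
      (fun p hp => hV₁₂ (Set.mk_mem_prod hp.1.1 hp.2.2)) (hmemU u hu).2 (hmemU u' hu').2
  -- the descended 2-cocycle of the finite quotient, through `Quotient.out` representatives
  set Q := absoluteGaloisGroup K ⧸ absGaloisFixingSubgroup E with hQ
  have hout : ∀ σ : absoluteGaloisGroup K, ∃ u ∈ absGaloisFixingSubgroup E,
      ((σ : Q)).out = σ * u := fun σ => by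
    obtain ⟨u, hu⟩ := QuotientGroup.mk_out_eq_mul (absGaloisFixingSubgroup E) σ
    exact ⟨u, u.2, hu⟩
  let f : Q × Q → Representation.invariants (ρ.toRepresentation.comp (absGaloisFixingSubgroup E).subtype) :=
    fun q => ⟨c.1 (q.1.out, q.2.out), fun s => htriv s s.2 _⟩
  have hf_mk : ∀ σ τ : absoluteGaloisGroup K, (f ((σ : Q), (τ : Q)) : M) = c.1 (σ, τ) := fun σ τ => by
    obtain ⟨u, hu, hσ⟩ := hout σ
    obtain ⟨u', hu', hτ⟩ := hout τ
    change c.1 (((σ : Q)).out, ((τ : Q)).out) = _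
    rw [hσ, hτ, hconst σ τ u u' hu hu']
  -- it is a 2-cocycle of the layer module
  have hf : f ∈ cocycles₂ (absGaloisLayerRep K E ρ) := by
    rw [mem_cocycles₂_iff]
    intro g h j
    induction g using QuotientGroup.induction_on with
    | H σ =>
    induction h using QuotientGroup.induction_on with
    | H τ =>
    induction j using QuotientGroup.induction_on with
    | H υ =>
    refine Subtype.ext ?_
    change (f (((σ : Q) * (τ : Q)), (υ : Q)) : M) + (f ((σ : Q), (τ : Q)) : M) =
      ρ σ (f ((τ : Q), (υ : Q)) : M) + (f ((σ : Q), ((τ : Q) * (υ : Q))) : M)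
    rw [← QuotientGroup.mk_mul, ← QuotientGroup.mk_mul, hf_mk, hf_mk, hf_mk, hf_mk]
    exact (c.2 σ τ υ).symm
  refine ⟨E, hEfd, hEgal, H2π (absGaloisLayerRep K E ρ) ⟨f, hf⟩, ?_⟩
  rw [infTwo_H2π]
  congr 1
  refine Subtype.ext (ContinuousMap.ext fun p => ?_)
  obtain ⟨σ, τ⟩ := p
  rw [inflateTwoCocycle_apply]
  exact hf_mk σ τ

end Literature.NumberTheory.GaloisRepresentations

end
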